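import Summits.ResolutionOfSingularities.ResolutionOfSingularities.Theorems.PurelyInseparableDim4SpivakovskyDeltaWT
import Summits.ResolutionOfSingularities.ResolutionOfSingularities.Theorems.PurelyInseparableDim4SpivakovskyLex
import HarnessLib

/-!
# [OURS · res-dim4-pi I-8-1 T2 ⇒ T3 hook] Every `δ`-descending permissible rule wins the spine game

Cell `res-dim4-pi` (D-0157 DOOR 2), seat `res-dim4-p-11`; the rule-level corollary of T1/T2 for CARD I-8-1 «R_W δ-steepest
descent» (idea-8; crit-1 V-A-18: «(L2) … gives a Lemma-2-free termination of R_S itself», and the domination (L1) makes R_W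
δ-descending).  [OURS · NEW-COMBINATION per crit-1; the δ-vector is Spivakovsky's [cite: Spivakovsky1983, §I (δ(Δ))].]

* `deltaSpine q A` — `δ` of a support read as the rational position `{a/q}` on all four coordinates;
* `IsDeltaDescending q σR` — the rule `σR : SpineStrategy` is permissible at every position A has not won, and every
  non-won child `pureMove q (σR A) j A` (`j ∈ σR A`) has `δ <_lex δ(A)`;
* **`IsDeltaDescending.isPurePositionalWin : 0 < q → IsDeltaDescending q σR → IsPurePositionalWin q σR`** — by T2
  (`no_infinite_delta_descent`): along an infinite pure play `δ` would drop for ever under denominators `q`;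
  `IsDeltaDescending.isSpinePositionalWin` (with deletions, via LEMMA D1);
* `isDeltaDescending_spineRuleLex` — R_S of record (`spineRuleLex`, the engines' MODE S) is δ-descending (T1 on supports), so
  `spineRuleLex` wins a second time, now through δ; the same one-liner applies to any rule DOMINATED by it, which is how
  idea-8's R_W (lex-argmin of the sorted children's δ over all permissible centres) becomes a theorem once typed (T3).

[OURS · counted 0 · AI work weaker than expert review] A statement about OUR frame's spine game; NOTHING here proves resolution
of singularities in dimension ≥ 4 / characteristic `p`. bears_on: LADDER-RESOLUTION:D157-DOOR2 (res-dim4-pi · I-8-1 T2/T3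
hook). Supports stmt-ResolutionOfSingularities-16155 (helper).
-/

set_option linter.dupNamespace false -- mandated namespace of this single-conjunct summit

open Finset
open scoped BigOperators

namespace Summit.ResolutionOfSingularities.ResolutionOfSingularities.Theorems.PIDim4

namespace Spivakovsky

open Literature.AlgebraicGeometry.Resolution
open Literature.AlgebraicGeometry.Resolution.CentreBlowup

/-- **`δ` of a support** (threshold `q`): Spivakovsky's vector of the rational position `{a/q : a ∈ A}` on all four
coordinates. [cite: Spivakovsky1983, §I (δ(Δ))] -/
noncomputable def deltaSpine (q : ℕ) (A : SpinePos) : List (WithTop ℚ) :=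
  delta (Finset.univ : Finset (Fin 4)) (A.image (spineScale q))

/-- **A `δ`-descending rule**: permissible wherever A has not won, and every not-yet-won child has a lex-smaller `δ`.
(idea-8's R_W satisfies this by domination over R_S; R_S satisfies it by T1.) [folklore] -/
def IsDeltaDescending (q : ℕ) (σR : SpineStrategy) : Prop :=
  ∀ A, ¬ SpineWon q A → SpinePermissible q (σR A) A ∧
    ∀ j ∈ σR A, ¬ SpineWon q (pureMove q (σR A) j A) →
      List.Lex (· < ·) (deltaSpine q (pureMove q (σR A) j A)) (deltaSpine q A)

namespace IsDeltaDescending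

variable {q : ℕ} {σR : SpineStrategy}

/-- **Every `δ`-descending rule wins the PURE spine game** (positional; `0 < q`).  Proof: an infinite pure play consists of
non-won positions, so `δ` drops at every step, contradicting T2 under the denominators `q`. [OURS · I-8-1 (L2)] [folklore] -/
theorem isPurePositionalWin (hq : 0 < q) (h : IsDeltaDescending q σR) : IsPurePositionalWin q σR := by
  refine ⟨fun A hA => (h A hA).1, ?_⟩
  rintro ⟨A, hplay⟩
  have hW : ∀ l, ¬ SpineWon q (A l) := fun l => (hplay l).1
  have hne : ∀ l, (A l).Nonempty := fun l => by
    rw [Finset.nonempty_iff_ne_empty]; exact fun h0 => hW l (Or.inl h0)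
  refine no_infinite_delta_descent (σ := Fin 4) 4 q hq (fun _ => Finset.univ) (fun l => (A l).image (spineScale q))
    (fun _ => by simp) (fun l => SpineRuleS.good_image (A l) (hne l)) (fun l => SpineRuleS.den_image hq (A l)) ?_
  intro l
  obtain ⟨-, j, hj, hstep⟩ := hplay l
  have hdrop := (h (A l) (hW l)).2 j hj (by rw [← hstep]; exact hW (l + 1))
  rw [← hstep] at hdrop
  exact hdrop

/-- … and the spine game WITH deletions (LEMMA D1, p-10 `SpineD1.isPurePlay_succ_of_isSpinePlay`). [folklore] -/
theorem isSpinePositionalWin (hq : 0 < q) (h : IsDeltaDescending q σR) : IsSpinePositionalWin q σR := by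
  obtain ⟨hperm, hno⟩ := h.isPurePositionalWin hq
  refine ⟨hperm, ?_⟩
  rintro ⟨A, hA⟩
  exact hno ⟨fun k => A (k + 1), SpineD1.isPurePlay_succ_of_isSpinePlay hperm hA⟩

end IsDeltaDescending

/-- **R_S of record is `δ`-descending** (T1 read on supports): for `0 < q`, at every position A has not won, every child of
`spineRuleLex q` — won or not — has a lex-smaller `δ`. [cite: Spivakovsky1983, §III Proposition] -/
theorem deltaSpine_pureMove_spineRuleLex_lt {q : ℕ} (hq : 0 < q) {A : SpinePos} (hA : ¬ SpineWon q A) {j : Fin 4}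
    (hj : j ∈ spineRuleLex q A) :
    List.Lex (· < ·) (deltaSpine q (pureMove q (spineRuleLex q A) j A)) (deltaSpine q A) := by
  have hne : A.Nonempty := by
    rw [Finset.nonempty_iff_ne_empty]; exact fun h0 => hA (Or.inl h0)
  have hgood := SpineRuleS.good_image (q := q) A hne
  have hd := SpineRuleS.one_le_dG_image hq hA
  unfold deltaSpine
  rw [SpineRuleS.image_pureMove hq (SpineRuleLex.spinePermissible hq hA)]
  exact delta_image_move_lt' isMinPermSel_minPermLex hgood hd hj

/-- **R_S of record is a `δ`-descending rule.** [cite: Spivakovsky1983, §III Proposition and Corollary] -/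
theorem isDeltaDescending_spineRuleLex {q : ℕ} (hq : 0 < q) : IsDeltaDescending q (spineRuleLex q) :=
  fun _ hA => ⟨SpineRuleLex.spinePermissible hq hA, fun _ hj _ => deltaSpine_pureMove_spineRuleLex_lt hq hA hj⟩

/-- **Domination hook for T3.**  A rule that is permissible off won positions and whose every non-won child has `δ` at most
(lex) the `δ` of SOME child of R_S of record at the same position is `δ`-descending, hence wins.  (idea-8's R_W minimises the
sorted list of the children's `δ` over all permissible centres, among them `spineRuleLex q A`, so its largest child `δ` is
`≤` the largest child `δ` of R_S; supplying that comparison per child is T3's remaining one line.) [folklore] -/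
theorem isDeltaDescending_of_dominated {q : ℕ} (hq : 0 < q) {σR : SpineStrategy}
    (hperm : ∀ A, ¬ SpineWon q A → SpinePermissible q (σR A) A)
    (hdom : ∀ A, ¬ SpineWon q A → ∀ j ∈ σR A, ¬ SpineWon q (pureMove q (σR A) j A) →
      ∃ j' ∈ spineRuleLex q A, ¬ List.Lex (· < ·) (deltaSpine q (pureMove q (spineRuleLex q A) j' A))
        (deltaSpine q (pureMove q (σR A) j A))) :
    IsDeltaDescending q σR := by
  intro A hA
  refine ⟨hperm A hA, fun j hj hnw => ?_⟩
  obtain ⟨j', hj', hle⟩ := hdom A hA j hj hnw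
  have hlt := deltaSpine_pureMove_spineRuleLex_lt hq hA hj'
  -- `δ(child) ≤ δ(R_S-child j') < δ(A)` in the linear order of `List (WithTop ℚ)` (whose `<` IS `List.Lex (· < ·)`)
  have hlt2 : deltaSpine q (pureMove q (spineRuleLex q A) j' A) < deltaSpine q A := hlt
  have hle2 : deltaSpine q (pureMove q (σR A) j A) ≤ deltaSpine q (pureMove q (spineRuleLex q A) j' A) := not_lt.mp hle
  exact lt_of_le_of_lt hle2 hlt2

end Spivakovsky

end Summit.ResolutionOfSingularities.ResolutionOfSingularities.Theorems.PIDim4
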